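import Mathlib
import HarnessLib

/-!
# The resampling-chain obstructions of random `k`-SAT (Huang–Sellke 2025, Lemmas 3.22–3.23) — named fact

Topic `Literature/Computability/Complexity` (random `k`-SAT files `RandomKSat*.lean`; companion of
`RandomKSatLowDegreeHardness.lean`, whose named fact `HuangSellke2025KSat` = Cor. 3.21 of
arXiv:2501.06427 is, in print, DERIVED from the two first-moment obstructions recorded here plus
generic machinery — grand correlation (Lemma 3.15), positivity and `L²`-stability of the resampling
kernel (Prop. 3.14), and the deterministic moat (Lemmas 3.24–3.25) — all of which are theorems being
proved summit-side). Vocabulary (statement only, D-0014):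

* `resampleKernel ε y y'` — the `ε`-resampling ("noise", `p = 1 − ε`-correlation) Markov kernel on a
  finite product space `ι → Γ` with the UNIFORM measure on `Γ`: every coordinate is kept with
  probability `1 − ε` and redrawn uniformly with probability `ε`, independently
  (Huang–Sellke 2025 §3.3 p. 21 "`(y, ŷ)` is `p`-correlated … `ŷ` is given by resampling from `μ`
  with probability `1 − p`"; O'Donnell 2014 Def. 8.26). Written as the explicit product
  `∏_i ((1−ε)·[y i = y' i] + ε/|Γ|)`.
* `resampleChainMass ε K E` — the mass of an event `E` on paths under the Markov chain
  `y⁽⁰⁾, …, y⁽ᴷ⁾` of that kernel started from the uniform measure (HS25 §3.3.2 p. 23: "a Markovian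
  sequence … `y⁽ᵗ⁺¹⁾` is obtained by resampling each of the `kM` IID entries in `y⁽ᵗ⁾` with
  probability `ε`"), as the finite weighted count `(Σ_y ∏_t P_ε(y t, y (t+1)) · [E y]) / |Γ|^{|ι|}`;
  paths are handed to `E` as `ℕ`-indexed sequences, constant after time `K`.
* `overlapPatCount`, `overlapEnt`, `overlapCondEnt` — Bresler–Huang's overlap profile entropy and
  CONDITIONAL OVERLAP ENTROPY `H(π(x^ℓ | x⁰, …, x^{ℓ−1}))` (arXiv:2106.02129 Def. 4.3, in nats): the
  profile of `ℓ` assignments is the empirical law, over a uniform position `i`, of the UNORDERED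
  partition `{S, T}` of `{0, …, ℓ−1}` by the value at `i`; we index it by the agreement pattern with
  rung `0` (`ξ j = [x^j_i ≠ x⁰_i]`, a bijection onto the partitions), so `overlapEnt` is the Shannon
  entropy of that pattern and, by the chain rule (BH Fact 4.5), the conditional overlap entropy is the
  difference `overlapEnt (ℓ+1) − overlapEnt ℓ`, which is the definition taken here.
* `HuangSellke2025KSatObstructions` — **Huang–Sellke 2025, Lemma 3.22 (ensemble OGP, "adaptation of
  [BH21]") and Lemma 3.23 (chaos, "adaptation of [BH21]")**, arXiv:2501.06427 §3.3.2 p. 23, for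
  random `k`-SAT `F_k(n, ⌊α n⌋)` at `α = κ 2^k log k / k`, `κ = 5`, in the with-replacement literal
  model (`Fin m × Fin k → Fin n × Bool`, literal `(v, b)` true under `σ` iff `σ v = b`; the tree's
  model of `RandomKSatThreshold.lean` / `HuangSellke2025KSat`, uncurried).

## Faithfulness notes (read at the page, arXiv:2501.06427v1 p. 23, and arXiv:2106.02129 §4.3–4.4)

Printed setting (p. 23): `D = o(N)`, `ε = log(N/D)/N`, `L = b/ε^{1/4}`, `K = ⌈1/(bε)⌉`, `b₀ = b k`,
"given `κ > κ*` we will choose `k` sufficiently large depending on `κ` and `b` sufficiently small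
depending on `(κ, k)`"; the chain `y⁽⁰⁾, …, y⁽ᴷ⁾` as above; `h` = the conditional overlap entropy of
[BH21]. Lemma 3.22: *there exist constants `(β, η)` depending on `k, κ` such that with probability
`1 − e^{−cN}` there do not exist `0 ≤ t₀ ≤ ⋯ ≤ t_k ≤ K` and assignments `x⁰, …, x^k` with `x^ℓ`
satisfying `y^{(t_ℓ)}` for all `ℓ` and `h(x^ℓ | x⁰ … x^{ℓ−1}) ∈ [β − η, β]` for `1 ≤ ℓ ≤ k`.*
Lemma 3.23: *with probability `1 − e^{−cN}` there do not exist `j ≤ k`, `0 ≤ t₀ ≤ ⋯ ≤ t_j ≤ K` with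
`t_j ≥ t_{j−1} + 1/(b₀ ε)`, and `x` satisfying `y^{(t_j)}` with `h(x | x^{(t₀)}, …, x^{(t_{j−1})}) ≤ β`,
where `x^{(t)}` is the algorithm's output on `y^{(t)}` ("must depend only on their respective inputs").*
Rendering choices, each weaker than or equal to the printed claim:
(i) `κ = 5 > κ* ≈ 4.911` only (as in `HuangSellke2025KSat`); (ii) deterministic output maps `a`
(the printed algorithm may use shared auxiliary randomness; a deterministic map is the special case),
quantified BEFORE the constant `c` and the threshold in `n` (for each fixed sequence of maps,
eventually); (iii) the band is written `[β − η, β]` with `0 < η < β` (printed: `[β−η, β]` "denoted in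
[BH21] as `[β₋ log k/k, β₊ log k/k]`", so `β − η = β₋ log k / k > 0`); (iv) "`b` sufficiently small" is
`∃ b₁ > 0, ∀ b ∈ (0, b₁]`, and `c` may depend on everything fixed before it (`k, b, D, a, A`);
(v) CHAIN LENGTH: the lemmas are printed for the length `K = ⌈1/(bε)⌉`; their proof ("bounding the
first moment of the number of such tuples … the contribution of any `(t₀, …, t_k)` is upper bounded by
the case `t₀ = ⋯ = t_k` … a union bound over the `N^{O(1)}` sequences of `t_j`") is uniform in the
time tuple and pays only the number `(K+1)^{k+1}` of tuples, so it yields the statement for every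
polynomially bounded length `K ≤ N^A` (threshold in `n` depending on `A`), which is the form recorded
(needed downstream because the `k` integer gaps `⌈1/(b k ε)⌉` may exceed `⌈1/(bε)⌉` by `k`);
(vi) probabilities are finite weighted counts (`resampleChainMass`); "with probability `1 − e^{−cN}`
there do not exist …" is "the mass of the paths carrying such a structure is `≤ exp(−c n)`".
Junk values: `t (j − 1)` is `ℕ`-subtraction guarded by `1 ≤ j`; `ε = log(n / D n)/n ≤ 0` and
`1/(b k ε)` meaningless only while `D n ≥ n`, excluded eventually since `D = o(n)`; at `n = 0` every
count is over a subsingleton — all clauses are eventual in `n`.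
`-- TODO(general form):` every `κ > κ*` (needs the constant `κ*` of [BH21] Thm. 2.6); randomised
algorithms with shared auxiliary randomness `(ω, U)`.

## References

* B. Huang, M. Sellke, *Strong low degree hardness for stable local optima in spin glasses*,
  arXiv:2501.06427 (2025), §3.3 (p. 21: `p`-correlated resampling, degree-`D` functions; Prop. 3.14,
  Lemma 3.15) and §3.3.2 (p. 23: Cor. 3.21, Lemmas 3.22–3.25) [HuangSellke2025].
* G. Bresler, B. Huang, *The algorithmic phase transition of random k-SAT for low degree
  polynomials*, FOCS 2021 / arXiv:2106.02129, Def. 4.3 (overlap profile, conditional overlap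
  entropy), Fact 4.5, §4.4 (`S_indep`, `S_ogp`), Prop. 4.7 [BreslerHuang2022].
* R. O'Donnell, *Analysis of Boolean Functions*, CUP 2014, Def. 8.26 (noise operator on general
  product spaces) [ODonnell2014].
-/

noncomputable section

namespace Literature.Computability.Complexity

open Finset Filter Asymptotics
open scoped Classical

/-! ### The resampling Markov chain on a finite product space -/

/-- **The `ε`-resampling kernel** on the finite product space `ι → Γ` (uniform measure on `Γ`): the
transition probability from `y` to `y'` when every coordinate is independently kept with probability
`1 − ε` and redrawn uniformly from `Γ` with probability `ε`,
`P_ε(y, y') = ∏_i ((1 − ε)·[y i = y' i] + ε/|Γ|)` — the kernel of the noise operator `T_{1−ε}`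
(O'Donnell 2014, Def. 8.26; Huang–Sellke 2025 §3.3, "`p`-correlated", `p = 1 − ε`). For `0 ≤ ε ≤ 1`
it is nonnegative, symmetric and stochastic. [cite: ODonnell2014, Def. 8.26] -/
def resampleKernel {ι Γ : Type*} [Fintype ι] [Fintype Γ] [DecidableEq Γ] (ε : ℝ) (y y' : ι → Γ) :
    ℝ :=
  ∏ i, ((1 - ε) * (if y i = y' i then (1 : ℝ) else 0) + ε / Fintype.card Γ)

/-- **Mass of an event under the `ε`-resampling Markov chain of length `K`** started from the uniform
measure on `ι → Γ` (Huang–Sellke 2025 §3.3.2: "a Markovian sequence `y⁽⁰⁾, …, y⁽ᴷ⁾` … `y⁽ᵗ⁺¹⁾` is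
obtained by resampling each of the entries of `y⁽ᵗ⁾` with probability `ε`"): the finite weighted
count `(Σ_{y : Fin (K+1) → (ι → Γ)} ∏_{t < K} P_ε(y t, y (t+1)) · [E y]) / |Γ|^{|ι|}`. The event reads
the path as an `ℕ`-indexed sequence, constant after time `K` (time `t` is `y (min t K)`).
[cite: HuangSellke2025, §3.3.2 (arXiv:2501.06427 p. 23)] -/
def resampleChainMass {ι Γ : Type*} [Fintype ι] [DecidableEq ι] [Fintype Γ] [DecidableEq Γ]
    (ε : ℝ) (K : ℕ) (E : (ℕ → ι → Γ) → Prop) : ℝ :=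
  (∑ y : Fin (K + 1) → ι → Γ,
      (∏ t : Fin K, resampleKernel ε (y t.castSucc) (y t.succ)) *
        (if E (fun t => y ⟨min t K, Nat.lt_succ_of_le (Nat.min_le_right t K)⟩) then (1 : ℝ)
          else 0)) / Fintype.card (ι → Γ)

/-! ### Bresler–Huang overlap profiles and conditional overlap entropy (Def. 4.3) -/

/-- **Overlap-pattern counts** (Bresler–Huang 2021, Def. 4.3): for a sequence of assignments
`Y 0, Y 1, … : Fin n → Bool`, the number of positions `i` whose agreement pattern with rung `0` over
the first `ℓ` rungs is `ξ` (`ξ j = [Y j i ≠ Y 0 i]`). The unordered partition `{S, T}` of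
`{0, …, ℓ−1}` of BH is `{ξ⁻¹ false, ξ⁻¹ true}`; patterns with `ξ 0 = true` have count `0`.
[cite: BreslerHuang2022, Def. 4.3 (arXiv:2106.02129 §4.3)] -/
def overlapPatCount {n : ℕ} (Y : ℕ → Fin n → Bool) (ℓ : ℕ) (ξ : Fin ℓ → Bool) : ℕ :=
  (univ.filter fun i : Fin n => (fun j : Fin ℓ => Bool.xor (Y j i) (Y 0 i)) = ξ).card

/-- **Overlap entropy** `H(π(Y 0, …, Y (ℓ−1)))` (nats) of Bresler–Huang 2021, Def. 4.3: the Shannon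
entropy `Σ_ξ η(N_ξ/n)`, `η = Real.negMulLog`, of the overlap profile (empirical law of the agreement
pattern over a uniform position). [cite: BreslerHuang2022, Def. 4.3 (arXiv:2106.02129 §4.3)] -/
def overlapEnt {n : ℕ} (Y : ℕ → Fin n → Bool) (ℓ : ℕ) : ℝ :=
  ∑ ξ : Fin ℓ → Bool, Real.negMulLog ((overlapPatCount Y ℓ ξ : ℝ) / n)

/-- **Conditional overlap entropy** `H(π(Y ℓ | Y 0, …, Y (ℓ−1)))` of Bresler–Huang 2021, Def. 4.3
(`= Σ_{S,T} π_{S,T} H(π_{·|S,T})`), rendered through the chain rule of BH Fact 4.5 as the difference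
of consecutive overlap entropies. It takes values in `[0, log 2]`, vanishes when `Y ℓ` repeats an
earlier rung (Fact 4.5), and is `h₂(Δ/n)`-continuous in `Y ℓ` for Hamming distance `Δ ≤ n/2`
(BH Lemma 4.8 = HS25 Lemma 3.24). [cite: BreslerHuang2022, Def. 4.3 and Fact 4.5 (arXiv:2106.02129 §4.3)] -/
def overlapCondEnt {n : ℕ} (Y : ℕ → Fin n → Bool) (ℓ : ℕ) : ℝ :=
  overlapEnt Y (ℓ + 1) - overlapEnt Y ℓ

/-! ### The named fact -/

/-- **Huang–Sellke 2025, Lemmas 3.22 (ensemble OGP) and 3.23 (chaos) for random `k`-SAT**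
(arXiv:2501.06427 §3.3.2 p. 23; adaptations of Bresler–Huang 2021 Prop. 4.7), `κ = 5`, deterministic
output maps. There is `k₀` such that for every `k ≥ k₀` there are `0 < η < β` and `b₁ > 0` such that
for every `0 < b ≤ b₁`, every degree sequence `D` with `1 ≤ D n` and `D = o(n)`, every sequence of
output maps `a n m : instances → assignments` and every exponent `A`, there is `c > 0` with,
eventually in `n` — writing `m = ⌊5·2^k log k/k · n⌋`, `ε = log(n / D n)/n`, and for every chain
length `K ≤ n^A` of the `ε`-resampling chain of literal arrays `Fin m × Fin k → Fin n × Bool`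
(literal `(v, b)` true under `x` iff `x v = b`) started uniformly:
* (OGP, Lemma 3.22) the paths carrying times `t 0 ≤ t 1 ≤ ⋯ ≤ t k ≤ K` and assignments
  `x 0, …, x k` such that `x ℓ` satisfies the instance at time `t ℓ` for every `ℓ ≤ k` and the
  conditional overlap entropy `H(x ℓ | x 0, …, x (ℓ−1))` lies in `[β − η, β]` for every `1 ≤ ℓ ≤ k`
  have mass `≤ exp(−c n)`;
* (CHAOS, Lemma 3.23) the paths carrying `1 ≤ j ≤ k`, times `t 0 ≤ ⋯ ≤ t j ≤ K` with
  `t j ≥ t (j−1) + 1/(b k ε)`, and an assignment `x` satisfying the instance at time `t j` with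
  `H(x | a (y (t 0)), …, a (y (t (j−1)))) ≤ β` have mass `≤ exp(−c n)`.
Printed for the chain length `K = ⌈1/(bε)⌉`; the printed proof (first moment per time tuple, union
bound over the `N^{O(1)}` tuples) gives every polynomially bounded length (module docstring, (v)).
Users take `(h : HuangSellke2025KSatObstructions)`.
[cite: HuangSellke2025, Lemmas 3.22–3.23 (arXiv:2501.06427 §3.3.2 p. 23)] -/
def HuangSellke2025KSatObstructions : Prop :=
  ∃ k₀ : ℕ, ∀ k : ℕ, k₀ ≤ k → ∃ β η : ℝ, 0 < η ∧ η < β ∧ ∃ b₁ : ℝ, 0 < b₁ ∧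
    ∀ b : ℝ, 0 < b → b ≤ b₁ → ∀ D : ℕ → ℕ,
      (fun n : ℕ => (D n : ℝ)) =o[atTop] (fun n : ℕ => (n : ℝ)) → (∀ n, 1 ≤ D n) →
      ∀ (a : (n m : ℕ) → (Fin m × Fin k → Fin n × Bool) → (Fin n → Bool)) (A : ℕ),
      ∃ c : ℝ, 0 < c ∧ ∀ᶠ n : ℕ in atTop, ∀ m : ℕ, m = ⌊5 * 2 ^ k * Real.log k / k * n⌋₊ →
        ∀ ε : ℝ, ε = Real.log (n / D n) / n → ∀ K : ℕ, K ≤ n ^ A →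
        resampleChainMass ε K (fun y : ℕ → (Fin m × Fin k → Fin n × Bool) =>
            ∃ (t : ℕ → ℕ) (x : ℕ → Fin n → Bool), (∀ ℓ < k, t ℓ ≤ t (ℓ + 1)) ∧ t k ≤ K ∧
              (∀ ℓ ≤ k, ∀ i : Fin m, ∃ j : Fin k, x ℓ (y (t ℓ) (i, j)).1 = (y (t ℓ) (i, j)).2) ∧
              ∀ ℓ, 1 ≤ ℓ → ℓ ≤ k → overlapCondEnt x ℓ ∈ Set.Icc (β - η) β)
          ≤ Real.exp (-(c * n)) ∧
        resampleChainMass ε K (fun y : ℕ → (Fin m × Fin k → Fin n × Bool) =>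
            ∃ (j : ℕ) (t : ℕ → ℕ) (x : Fin n → Bool), 1 ≤ j ∧ j ≤ k ∧
              (∀ ℓ < j, t ℓ ≤ t (ℓ + 1)) ∧ t j ≤ K ∧ (t (j - 1) : ℝ) + 1 / (b * k * ε) ≤ t j ∧
              (∀ i : Fin m, ∃ j' : Fin k, x (y (t j) (i, j')).1 = (y (t j) (i, j')).2) ∧
              overlapCondEnt (fun ℓ => if ℓ < j then a n m (y (t ℓ)) else x) j ≤ β)
          ≤ Real.exp (-(c * n))
-- TODO(general form): every `κ > κ*` ([BH21] Thm. 2.6 constant); randomised algorithms with shared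
-- auxiliary randomness `(ω, U)`; the printed chain length is `K = ⌈1/(bε)⌉` (see (v)).

/-! ### The ensemble-OGP half alone (appended 2026-08-16, prover-line-stmt-PneNP-2460-c1-0)

The CHAOS half (Lemma 3.23) of `HuangSellke2025KSatObstructions` is an elementary first moment on the
resampling chain (Markov property, the count of low-conditional-entropy candidates
`≤ (n+1)^{2^j} e^{nβ}` of Bresler–Huang §4.6, and the satisfaction probability `≤ (1 − (E/2)^k)^m` of
a fixed assignment under resampling at rate `E ≥ 1 − e^{−1/(bk)}`), valid for EVERY `β < 5 log k / k`
and all small `b`; it is being proved summit-side. What then remains of print is Lemma 3.22 alone,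
recorded here with the one extra property of its printed constants that the chaos computation consumes:
`β < 5 log k / k` (HS25's `β` is Bresler–Huang's `β₊ log k / k`, and `β₊ < β_max < κ = 5` since
`ι(β) = β/(1 − β e^{−(β−1)}) > β` for `β > 1` and `ι(β_max) = κ`, arXiv:2106.02129 §4.4). -/

/-- **Huang–Sellke 2025, Lemma 3.22 (ensemble OGP on the resampling chain) for random `k`-SAT**
(arXiv:2501.06427 §3.3.2 p. 23; adaptation of Bresler–Huang 2021 Prop. 4.7(iii)), `κ = 5`: there is
`k₀` such that for every `k ≥ k₀` there are constants `0 < η < β < 5 log k / k` (the printed band is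
`[β − η, β] = [β₋ log k/k, β₊ log k/k]` with `1 < β₋ < β₊ < β_max < κ = 5`) such that for every
degree sequence `D` with `1 ≤ D n`, `D = o(n)`, and every exponent `A` there is `c > 0` with,
eventually in `n` — `m = ⌊5·2^k log k/k · n⌋`, `ε = log(n / D n)/n`, every chain length `K ≤ n^A`
(the printed length is `K = ⌈1/(bε)⌉`; the printed proof, a first moment per time tuple and a union
bound over the `N^{O(1)}` tuples, gives every polynomially bounded length) — the paths of the
`ε`-resampling chain of literal arrays carrying times `t 0 ≤ ⋯ ≤ t k ≤ K` and assignments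
`x 0, …, x k`, `x ℓ` satisfying the instance at time `t ℓ` for every `ℓ ≤ k`, with every conditional
overlap entropy `H(x ℓ | x 0, …, x (ℓ−1)) ∈ [β − η, β]` (`1 ≤ ℓ ≤ k`), have mass `≤ exp(−c n)`.
Together with the (provable) chaos computation it yields `HuangSellke2025KSatObstructions`.
Users take `(h : HuangSellke2025KSatEnsembleOGP)`.
[cite: HuangSellke2025, Lemma 3.22 (arXiv:2501.06427 §3.3.2 p. 23)] -/
def HuangSellke2025KSatEnsembleOGP : Prop :=
  ∃ k₀ : ℕ, ∀ k : ℕ, k₀ ≤ k → ∃ β η : ℝ, 0 < η ∧ η < β ∧ β < 5 * Real.log k / k ∧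
    ∀ D : ℕ → ℕ, (fun n : ℕ => (D n : ℝ)) =o[atTop] (fun n : ℕ => (n : ℝ)) → (∀ n, 1 ≤ D n) →
      ∀ A : ℕ, ∃ c : ℝ, 0 < c ∧ ∀ᶠ n : ℕ in atTop, ∀ m : ℕ, m = ⌊5 * 2 ^ k * Real.log k / k * n⌋₊ →
        ∀ ε : ℝ, ε = Real.log (n / D n) / n → ∀ K : ℕ, K ≤ n ^ A →
        resampleChainMass ε K (fun y : ℕ → (Fin m × Fin k → Fin n × Bool) =>
            ∃ (t : ℕ → ℕ) (x : ℕ → Fin n → Bool), (∀ ℓ < k, t ℓ ≤ t (ℓ + 1)) ∧ t k ≤ K ∧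
              (∀ ℓ ≤ k, ∀ i : Fin m, ∃ j : Fin k, x ℓ (y (t ℓ) (i, j)).1 = (y (t ℓ) (i, j)).2) ∧
              ∀ ℓ, 1 ≤ ℓ → ℓ ≤ k → overlapCondEnt x ℓ ∈ Set.Icc (β - η) β)
          ≤ Real.exp (-(c * n))
-- TODO(general form): every `κ > κ*`; the printed chain length is `K = ⌈1/(bε)⌉`.

end Literature.Computability.Complexity

end
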